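import Summits.QuantumAdvantage.QuantumAdvantage.Theorems.SparsityDialMP9

/-!
# SparsityDial — part MP10 of 10 of the «MovingPointers» package (decomp-qadv lens 2, g18): §E THE AFFINE-TABLE THEOREM `table_loss` / `AffineTableLoss3` (PROVED) + S-form `affineTableLossS3`; §F typed residual `PolyTableLoss3`

Imports its predecessor `SparsityDialMP9` (linear chain MP1 → … → MP10); the package overview is the module docstring of `SparsityDialMP1`.
No `sorry`; standard axioms; no instances / notation.
-/

set_option linter.unusedVariables false
set_option linter.dupNamespace false

noncomputable section
open scoped Classical

namespace Summit.QuantumAdvantage.QuantumAdvantage.Theorems.SparsityDial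

open Finset
open Literature.Computability.QuantumComplexity Literature.Computability.QuantumComplexity.RingHLF
open Literature.Computability.MetaComplexity Literature.Computability.MetaComplexity.Smolensky
open Summit.QuantumAdvantage.AdviceFreeQNC0
open Summit.QuantumAdvantage.QuantumAdvantage.Theorems.HolonomyDial (gCond)
open Summit.QuantumAdvantage.QuantumAdvantage.Theorems.LocusDial
open Summit.QuantumAdvantage.QuantumAdvantage.Theorems.AnchorDial (dev outB win_iff card_odd_ge)
open Summit.QuantumAdvantage.QuantumAdvantage.Theorems.HolonomyDial (card_odd_le)
open Summit.QuantumAdvantage.QuantumAdvantage.Theorems.StabilizerDial (eventually_polylog StabFew stabFew_of_fewLocus)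

/-! ## §E  AFFINE TABLES: `dev P x = S(L x)` for an ARBITRARY set-valued table `S` with values of size `≤ (log₂ n)^c` -/

section Table
variable {N t : ℕ}

/-- tables with small values are sparse with the zero gauge. -/
theorem fewLocus_of_dev_card {K : ℕ} (P : Fin N → CubeFn (ZMod 3) N)
    (h : ∀ x, OddZeros x → (dev P x).card ≤ K) : FewLocus K 0 P := by
  have hcov : ∀ x : Fin N → Bool, OddZeros x → Coverable K 0 (dev P x) := by
    intro x hx
    set S := dev P x with hS
    refine ⟨fun i => if hi : i.val < S.card then (S.orderEmbOfFin rfl ⟨i.val, hi⟩).val else 0, ?_⟩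
    intro q hq
    have hq' : q ∈ Set.range (S.orderEmbOfFin rfl) := by rw [Finset.range_orderEmbOfFin]; exact hq
    obtain ⟨l, hl⟩ := hq'
    refine ⟨⟨l.val, lt_of_lt_of_le l.isLt (h x hx)⟩, ?_⟩
    simp only [dif_pos l.isLt, Fin.eta, hl, add_zero, le_refl, and_self]
  have hempty : (univ.filter fun x : Fin N → Bool => OddZeros x ∧ ¬ Coverable K 0 (dev P x)) = ∅ :=
    filter_eq_empty_iff.mpr fun x _ h' => h'.2 (hcov x h'.1)
  show Nat.log 2 N * _ ≤ _
  rw [hempty, card_empty, mul_zero]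
  exact Nat.zero_le _

/-- **per fibre**: a table value `Sv` of size `≤ m`, enumerated increasingly, is an injective tuple — losers counted directly. -/
theorem fibre_losers_set (hN : 3 ≤ N) (M : Fin t → Fin N → ZMod 3) (v : Fin t → ZMod 3) (Sv : Finset (Fin N))
    (m j : ℕ) (hcard : Sv.card ≤ m) (hwN : (m + 1) * (2 * j) + 1 ≤ N) (hj : 1 ≤ j) (hjt : 8 * (t + m + 3) + 20 ≤ j)
    (P : Fin N → CubeFn (ZMod 3) N) (hdev : ∀ x ∈ fib M v, dev P x = Sv) :
    ((fib M v).card : ℝ) ≤ 3 * ((fib M v).filter (fun x => ¬ Rel x (outB P x))).card + 2 ^ N / (144 * 3 ^ t) := by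
  set mv := Sv.card with hmv
  set k : Fin mv → Fin N := fun l => Sv.orderEmbOfFin rfl l with hk
  have hinj : Function.Injective k := (Sv.orderEmbOfFin rfl).injective
  have himg : univ.image k = Sv := by
    ext a
    rw [mem_image]
    constructor
    · rintro ⟨l, _, rfl⟩
      exact Sv.orderEmbOfFin_mem rfl l
    · intro ha
      have ha' : a ∈ Set.range (Sv.orderEmbOfFin rfl) := by rw [Finset.range_orderEmbOfFin]; exact ha
      obtain ⟨l, hl⟩ := ha'
      exact ⟨l, mem_univ _, hl⟩
  have hwN' : (mv + 1) * (2 * j) + 1 ≤ N := by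
    have : (mv + 1) * (2 * j) ≤ (m + 1) * (2 * j) := Nat.mul_le_mul_right _ (by omega)
    omega
  obtain ⟨w, hwN2, hwl⟩ := exists_free_window (fun l => (k l).val) j hj hwN'
  have hjt' : 8 * (t + mv + 3) + 20 ≤ j := by omega
  have hB := fibre_losers_dir_ge M v (fun l => (k l).val) (dirVec (fun l => (k l).val) w j)
    (dirVec_ne_zero _ w j) (2 ^ N / (432 * 3 ^ mv * 3 ^ t)) (by positivity)
    (fun α a hα => by
      have hb := fibSumM_bound_window M v α a (fun l => (k l).val) w j hα hwl hwN2 hjt'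
      rw [le_div_iff₀ (by positivity)]
      linarith)
  have hset : (fib M v).filter (fun x => Even ((univ : Finset (Fin mv)).filter (fun l => kph x (k l).val ≠ 2)).card) =
      (fib M v).filter (fun x => ¬ Rel x (outB P x)) := by
    apply filter_congr
    intro x hx
    have hxodd : OddZeros x := by
      have h1 := hx
      unfold fib at h1
      rw [mem_filter, mem_filter] at h1
      exact h1.1.2
    rw [lose_iff_of_dev_image hN P x hxodd k hinj (by rw [hdev x hx, himg])]
  rw [hset] at hB
  have e : (3 : ℝ) ^ (mv + 1) * (2 ^ N / (432 * 3 ^ mv * 3 ^ t)) = 2 ^ N / (144 * 3 ^ t) := by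
    rw [pow_succ]; field_simp; ring
  rw [e] at hB
  exact hB

/-- **THE AFFINE-TABLE LOSS THEOREM**: `dev P x = S(L x)` on odd inputs for an `𝔽₃`-linear hash `L` with `t` forms and ANY
table `S` with values of size `≤ m`; if `(m+1)·2j + 1 ≤ N` and `8(t+m+3) + 20 ≤ j` then `#odd ≤ 4·#{odd losers}`. -/
theorem table_loss (hN : 3 ≤ N) (M : Fin t → Fin N → ZMod 3) (S : (Fin t → ZMod 3) → Finset (Fin N)) (m j : ℕ)
    (hcard : ∀ v, (S v).card ≤ m) (hwN : (m + 1) * (2 * j) + 1 ≤ N) (hj : 1 ≤ j) (hjt : 8 * (t + m + 3) + 20 ≤ j)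
    (P : Fin N → CubeFn (ZMod 3) N) (hdev : ∀ x, OddZeros x → dev P x = S (linHash M x)) :
    (univ.filter fun x : Fin N → Bool => OddZeros x).card ≤
      4 * (univ.filter fun x : Fin N → Bool => OddZeros x ∧ ¬ Rel x (outB P x)).card := by
  set O := (univ.filter fun x : Fin N → Bool => OddZeros x).card with hO
  set L := (univ.filter fun x : Fin N → Bool => OddZeros x ∧ ¬ Rel x (outB P x)).card with hL
  have hOdd_fib : O = ∑ v : Fin t → ZMod 3, (fib M v).card := by
    rw [hO, card_eq_sum_card_fiberwise (f := fun x => linHash M x) (t := (univ : Finset (Fin t → ZMod 3)))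
      (fun x _ => mem_univ _)]
    rfl
  have hL_fib : L = ∑ v : Fin t → ZMod 3, ((fib M v).filter (fun x => ¬ Rel x (outB P x))).card := by
    rw [hL, card_eq_sum_card_fiberwise (f := fun x => linHash M x) (t := (univ : Finset (Fin t → ZMod 3)))
      (fun x _ => mem_univ _)]
    apply sum_congr rfl
    intro v _
    congr 1
    unfold fib
    ext x
    simp only [mem_filter, mem_univ, true_and]
    constructor
    · rintro ⟨⟨hx, hk⟩, hv⟩
      exact ⟨⟨hx, hv⟩, hk⟩
    · rintro ⟨⟨hx, hv⟩, hk⟩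
      exact ⟨⟨hx, hk⟩, hv⟩
  have hfib : ∀ v : Fin t → ZMod 3, ((fib M v).card : ℝ) ≤
      3 * ((fib M v).filter (fun x => ¬ Rel x (outB P x))).card + 2 ^ N / (144 * 3 ^ t) := by
    intro v
    refine fibre_losers_set hN M v (S v) m j (hcard v) hwN hj hjt P ?_
    intro x hx
    have h1 := hx
    unfold fib at h1
    rw [mem_filter, mem_filter] at h1
    rw [hdev x h1.1.2, h1.2]
  have hs := sum_le_sum (fun v (_ : v ∈ (univ : Finset (Fin t → ZMod 3))) => hfib v)
  rw [sum_add_distrib, ← mul_sum, sum_const, card_univ, Fintype.card_fun, ZMod.card, Fintype.card_fin,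
    nsmul_eq_mul] at hs
  push_cast at hs
  have e : (3 : ℝ) ^ t * (2 ^ N / (144 * 3 ^ t)) = 2 ^ N / 144 := by
    field_simp
  rw [e] at hs
  have hOge : 2 ^ (N - 1) ≤ O := card_odd_ge (by omega)
  have hOge' : (2 : ℝ) ^ (N - 1) ≤ O := by exact_mod_cast hOge
  have hpow : (2 : ℝ) ^ N = 2 * 2 ^ (N - 1) := by
    rw [← pow_succ']; congr 1; omega
  have hOR : (O : ℝ) = ∑ v : Fin t → ZMod 3, ((fib M v).card : ℝ) := by rw [hOdd_fib]; push_cast; rfl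
  have hLR : (L : ℝ) = ∑ v : Fin t → ZMod 3, (((fib M v).filter (fun x => ¬ Rel x (outB P x))).card : ℝ) := by
    rw [hL_fib]; push_cast; rfl
  have h5 : (O : ℝ) ≤ 3 * L + 2 ^ N / 144 := by rw [hOR, hLR]; exact hs
  have hreal : (O : ℝ) ≤ 4 * L := by
    rw [hpow] at h5
    nlinarith [h5, hOge']
  exact_mod_cast hreal

/-- **the rung `AffineTableLoss3`**: every strategy whose deviation set at each odd input is read off an `𝔽₃`-linear hash
of the input with `t ≤ (log₂ n)^c` forms by an ARBITRARY table with values of size `≤ (log₂ n)^c` wins on at most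
`(1 − n^{-C})·2^{n−1}` odd inputs. -/
def AffineTableLoss3 : Prop := ∃ C : ℕ, ∀ c : ℕ, ∃ n₀ : ℕ, ∀ n ≥ n₀, ∀ t ≤ (Nat.log 2 n) ^ c,
  ∀ (M : Fin t → Fin n → ZMod 3) (S : (Fin t → ZMod 3) → Finset (Fin n)), (∀ v, (S v).card ≤ (Nat.log 2 n) ^ c) →
    ∀ P : Fin n → CubeFn (ZMod 3) n, (∀ x, OddZeros x → dev P x = S (linHash M x)) →
      ((univ.filter fun x : Fin n → Bool => OddZeros x ∧ Rel x (fun i => decide (P i x = 1))).card : ℝ) ≤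
        (1 - 1 / (n : ℝ) ^ C) * (2 : ℝ) ^ (n - 1)

/-- **`AffineTableLoss3` PROVED** (`C = 1`). -/
theorem affineTableLoss3 : AffineTableLoss3 := by
  refine ⟨1, fun c => ?_⟩
  obtain ⟨n₀, hn₀⟩ := eventually_polylog 1920 (2 * c)
  refine ⟨n₀, fun n hn t ht M S hcard P hdev => ?_⟩
  obtain ⟨hK, hL⟩ := hn₀ n hn
  set A := (Nat.log 2 n) ^ c with hA
  have hA1 : 1 ≤ A := Nat.one_le_pow _ _ (by omega)
  have hA2 : (Nat.log 2 n) ^ (2 * c) = A * A := by rw [hA, ← pow_add]; ring_nf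
  rw [hA2] at hK
  have hn2 : 1920 * (A * A) ≤ n := le_trans hK (Nat.div_le_self n 2)
  have h4 : 4 ≤ n := by nlinarith
  have h3 : 3 ≤ n := by omega
  set d := n / (4 * (A + 1)) with hd
  have hdA : d * (4 * (A + 1)) ≤ n := Nat.div_mul_le_self n (4 * (A + 1))
  have hdge : 32 * A + 88 ≤ d := by
    rw [hd, Nat.le_div_iff_mul_le (by omega)]
    nlinarith
  set j := d / 2 with hj
  have hjt : 8 * (t + A + 3) + 20 ≤ j := by omega
  have hj1 : 1 ≤ j := by omega
  have h2jd : 2 * j ≤ d := by omega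
  have hw1 : (A + 1) * (2 * j) ≤ (A + 1) * d := Nat.mul_le_mul (le_refl _) h2jd
  have hw2 : (A + 1) * d * 4 ≤ n := by
    have e : (A + 1) * d * 4 = d * (4 * (A + 1)) := by ring
    rw [e]; exact hdA
  have hwN : (A + 1) * (2 * j) + 1 ≤ n := by omega
  have hq := table_loss (N := n) h3 M S A j hcard hwN hj1 hjt P hdev
  exact real_loss_of_frac (M := 4) (by norm_num) (by omega) h3 P hq

/-- by name: `AffineTableLoss3 → AffineLookupLoss3` (a tuple's image is a table value of size `≤ m`). -/
theorem lookup_of_table (h : AffineTableLoss3) : AffineLookupLoss3 := by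
  obtain ⟨C, hC⟩ := h
  refine ⟨C, fun c => ?_⟩
  obtain ⟨n₀, hn₀⟩ := hC c
  refine ⟨n₀, fun n hn t ht m hm M π hinj P hdev => ?_⟩
  refine hn₀ n hn t ht M (fun v => univ.image (π v)) ?_ P hdev
  intro v
  refine le_trans card_image_le ?_
  rw [card_univ, Fintype.card_fin]; exact hm

/-- **`AffineTableLossS3`** — the affine-table family under piece S's own hypotheses, `∀ c, ∃ C` order (LITERALLY below S). -/
def AffineTableLossS3 : Prop := ∀ c : ℕ, ∃ C : ℕ, ∃ n₀ : ℕ, ∀ n ≥ n₀, ∀ t ≤ (Nat.log 2 n) ^ c,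
  ∀ (M : Fin t → Fin n → ZMod 3) (S : (Fin t → ZMod 3) → Finset (Fin n)), (∀ v, (S v).card ≤ (Nat.log 2 n) ^ c) →
    ∀ P : Fin n → CubeFn (ZMod 3) n, (∀ i, P i ∈ lowDeg (ZMod 3) n ((Nat.log 2 n) ^ c)) →
      ¬ StabFew 1 0 (c + 1) P →
      (∀ x, OddZeros x → dev P x = S (linHash M x)) →
      ((univ.filter fun x : Fin n → Bool => OddZeros x ∧ Rel x (fun i => decide (P i x = 1))).card : ℝ) ≤
        (1 - 1 / (n : ℝ) ^ C) * (2 : ℝ) ^ (n - 1)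

/-- BY NAME: piece S (landed `Theorems.SparsityDial.SparseGenericLoss3`) implies the S-restricted affine-table statement. -/
theorem tableS_of_sparse (hS : SparseGenericLoss3) : AffineTableLossS3 := by
  intro c
  obtain ⟨C, hC⟩ := hS c
  obtain ⟨n₀, hn₀⟩ := hC c
  refine ⟨C, n₀, fun n hn t ht M S hcard P hdeg hnot hdev => ?_⟩
  refine hn₀ n hn P hdeg (stabFew_of_fewLocus (c + 1) (fewLocus_of_dev_card P ?_)) hnot
  intro x hx
  rw [hdev x hx]; exact hcard _


/-- SparsityDial «MovingPointers» helper `tableS_of_table` (decomp-qadv lens-2 g18 land package; see the module docstring). -/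
theorem tableS_of_table (h : AffineTableLoss3) : AffineTableLossS3 := by
  obtain ⟨C, hC⟩ := h
  intro c
  obtain ⟨n₀, hn₀⟩ := hC c
  exact ⟨C, n₀, fun n hn t ht M S hcard P _ _ hdev => hn₀ n hn t ht M S hcard P hdev⟩

/-- **S DECIDED on the whole AFFINE-TABLE class: `AffineTableLossS3` PROVED.** -/
theorem affineTableLossS3 : AffineTableLossS3 := tableS_of_table affineTableLoss3

end Table

/-- info: 'Summit.QuantumAdvantage.QuantumAdvantage.Theorems.SparsityDial.table_loss' depends on axioms: [propext,
 Classical.choice,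
 Quot.sound] -/
#guard_msgs in #print axioms table_loss
/-- info: 'Summit.QuantumAdvantage.QuantumAdvantage.Theorems.SparsityDial.affineTableLoss3' depends on axioms: [propext,
 Classical.choice,
 Quot.sound] -/
#guard_msgs in #print axioms affineTableLoss3
/-- info: 'Summit.QuantumAdvantage.QuantumAdvantage.Theorems.SparsityDial.affineTableLossS3' depends on axioms: [propext,
 Classical.choice,
 Quot.sound] -/
#guard_msgs in #print axioms affineTableLossS3
/-- info: 'Summit.QuantumAdvantage.QuantumAdvantage.Theorems.SparsityDial.lookup_of_table' depends on axioms: [propext,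
 Classical.choice,
 Quot.sound] -/
#guard_msgs in #print axioms lookup_of_table


/-! ## §F  THE TYPED RESIDUAL OF S after REV 5: tables indexed by LOW-DEGREE (non-linear) hashes — `PolyTableLoss3` -/

section PolyTable
variable {N t : ℕ}

open Summit.QuantumAdvantage.QuantumAdvantage.Theorems.LocusDial (linPoly linPoly_apply linPoly_mem)

/-- **`PolyTableLoss3`** (the next rung ABOVE `AffineTableLoss3`, NOT proved here): `dev P x = S(h x)` on odd inputs for a hash
`h : Fin t → CubeFn (ZMod 3) n` of `t ≤ (log₂ n)^c` cube functions of DEGREE `≤ (log₂ n)^c` (not just linear forms) and an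
arbitrary table `S` with values of size `≤ (log₂ n)^c` ⇒ at most `(1 − n^{-C})·2^{n−1}` odd wins.  Degree `1` is
`AffineTableLoss3` (PROVED; `affineTable_of_polyTable` below is the by-name link).  BARRIER PLACEMENT: the fibre method of this
file would need `3^{-t}`-small (`t` polylog) correlation of the kernel-automaton character with `χ ∘ q` for `q` an
`𝔽₃`-polynomial of degree `(log₂ n)^c ≫ log n` in the `0/1` variables — "superpolynomially small correlation against polynomials
of degree `≫ log n`", which derivative / Gowers-norm arguments cannot deliver
(`Literature.Barriers.QuantumAdvantage.NonclassicalDegreeLogBarrier`, Bhowmick–Lovett 2015, PROVED in the tree); the transfer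
operator of parts AffinePointerA–C is the degree-1 case only.  Tag: WEAKER than S (`polyTableS_of_sparse`), IDEA-NEEDED,
inside the degree-`log n` barrier for the one known method. -/
def PolyTableLoss3 : Prop := ∃ C : ℕ, ∀ c : ℕ, ∃ n₀ : ℕ, ∀ n ≥ n₀, ∀ t ≤ (Nat.log 2 n) ^ c,
  ∀ (h : Fin t → CubeFn (ZMod 3) n) (S : (Fin t → ZMod 3) → Finset (Fin n)),
    (∀ s, h s ∈ lowDeg (ZMod 3) n ((Nat.log 2 n) ^ c)) → (∀ v, (S v).card ≤ (Nat.log 2 n) ^ c) →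
    ∀ P : Fin n → CubeFn (ZMod 3) n, (∀ x, OddZeros x → dev P x = S (fun s => h s x)) →
      ((univ.filter fun x : Fin n → Bool => OddZeros x ∧ Rel x (fun i => decide (P i x = 1))).card : ℝ) ≤
        (1 - 1 / (n : ℝ) ^ C) * (2 : ℝ) ^ (n - 1)

/-- **`PolyTableLossS3`** — the same family under piece S's own hypotheses (`∀ c, ∃ C` order): THE TYPED RESIDUAL OF S. -/
def PolyTableLossS3 : Prop := ∀ c : ℕ, ∃ C : ℕ, ∃ n₀ : ℕ, ∀ n ≥ n₀, ∀ t ≤ (Nat.log 2 n) ^ c,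
  ∀ (h : Fin t → CubeFn (ZMod 3) n) (S : (Fin t → ZMod 3) → Finset (Fin n)),
    (∀ s, h s ∈ lowDeg (ZMod 3) n ((Nat.log 2 n) ^ c)) → (∀ v, (S v).card ≤ (Nat.log 2 n) ^ c) →
    ∀ P : Fin n → CubeFn (ZMod 3) n, (∀ i, P i ∈ lowDeg (ZMod 3) n ((Nat.log 2 n) ^ c)) →
      ¬ StabFew 1 0 (c + 1) P →
      (∀ x, OddZeros x → dev P x = S (fun s => h s x)) →
      ((univ.filter fun x : Fin n → Bool => OddZeros x ∧ Rel x (fun i => decide (P i x = 1))).card : ℝ) ≤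
        (1 - 1 / (n : ℝ) ^ C) * (2 : ℝ) ^ (n - 1)

/-- BY NAME: piece S implies the typed residual (tables with small values are zero-gauge sparse). -/
theorem polyTableS_of_sparse (hS : SparseGenericLoss3) : PolyTableLossS3 := by
  intro c
  obtain ⟨C, hC⟩ := hS c
  obtain ⟨n₀, hn₀⟩ := hC c
  refine ⟨C, n₀, fun n hn t ht h S hdegh hcard P hdeg hnot hdev => ?_⟩
  refine hn₀ n hn P hdeg (stabFew_of_fewLocus (c + 1) (fewLocus_of_dev_card P ?_)) hnot
  intro x hx
  rw [hdev x hx]; exact hcard _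

/-- SparsityDial «MovingPointers» helper `polyTableS_of_polyTable` (decomp-qadv lens-2 g18 land package; see the module docstring). -/
theorem polyTableS_of_polyTable (h : PolyTableLoss3) : PolyTableLossS3 := by
  obtain ⟨C, hC⟩ := h
  intro c
  obtain ⟨n₀, hn₀⟩ := hC c
  exact ⟨C, n₀, fun n hn t ht h S hdegh hcard P _ _ hdev => hn₀ n hn t ht h S hdegh hcard P hdev⟩

/-- a linear hash is a degree-`1 ≤ (log₂ n)^c` hash (`n ≥ 2`): the tree's `linPoly`, `linPoly_mem`, `linPoly_apply`. -/
theorem linHash_lowDeg {n c : ℕ} (hn : 2 ≤ n) (M : Fin t → Fin n → ZMod 3) (s : Fin t) :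
    linPoly M s ∈ lowDeg (ZMod 3) n ((Nat.log 2 n) ^ c) := by
  have h1 : 1 ≤ (Nat.log 2 n) ^ c := Nat.one_le_pow _ _ (Nat.log_pos (by norm_num) hn)
  exact lowDeg_mono h1 (linPoly_mem M s)

/-- SparsityDial «MovingPointers» helper `linHash_eq_linPoly` (decomp-qadv lens-2 g18 land package; see the module docstring). -/
theorem linHash_eq_linPoly {n : ℕ} (M : Fin t → Fin n → ZMod 3) (x : Fin n → Bool) :
    (fun s => linPoly M s x) = linHash M x := by
  funext s; exact linPoly_apply M s x

/-- BY NAME: the residual rung implies the PROVED affine-table rung (degree 1 is the affine case). -/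
theorem affineTable_of_polyTable (h : PolyTableLoss3) : AffineTableLoss3 := by
  obtain ⟨C, hC⟩ := h
  refine ⟨C, fun c => ?_⟩
  obtain ⟨n₀, hn₀⟩ := hC c
  refine ⟨max n₀ 2, fun n hn t ht M S hcard P hdev => ?_⟩
  have hn2 : 2 ≤ n := le_of_max_le_right hn
  refine hn₀ n (le_of_max_le_left hn) t ht (fun s => linPoly M s) S (fun s => linHash_lowDeg hn2 M s) hcard P ?_
  intro x hx
  rw [linHash_eq_linPoly]; exact hdev x hx

/-- SparsityDial «MovingPointers» helper `affineTableS_of_polyTableS` (decomp-qadv lens-2 g18 land package; see the module docstring). -/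
theorem affineTableS_of_polyTableS (h : PolyTableLossS3) : AffineTableLossS3 := by
  intro c
  obtain ⟨C, n₀, hn₀⟩ := h c
  refine ⟨C, max n₀ 2, fun n hn t ht M S hcard P hdeg hnot hdev => ?_⟩
  have hn2 : 2 ≤ n := le_of_max_le_right hn
  refine hn₀ n (le_of_max_le_left hn) t ht (fun s => linPoly M s) S (fun s => linHash_lowDeg hn2 M s) hcard P
    hdeg hnot ?_
  intro x hx
  rw [linHash_eq_linPoly]; exact hdev x hx

end PolyTable

/-- info: 'Summit.QuantumAdvantage.QuantumAdvantage.Theorems.SparsityDial.polyTableS_of_sparse' depends on axioms: [propext,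
 Classical.choice,
 Quot.sound] -/
#guard_msgs in #print axioms polyTableS_of_sparse
/-- info: 'Summit.QuantumAdvantage.QuantumAdvantage.Theorems.SparsityDial.affineTable_of_polyTable' depends on axioms: [propext,
 Classical.choice,
 Quot.sound] -/
#guard_msgs in #print axioms affineTable_of_polyTable
/-- info: 'Summit.QuantumAdvantage.QuantumAdvantage.Theorems.SparsityDial.affineTableS_of_polyTableS' depends on axioms: [propext,
 Classical.choice,
 Quot.sound] -/
#guard_msgs in #print axioms affineTableS_of_polyTableS



end Summit.QuantumAdvantage.QuantumAdvantage.Theorems.SparsityDial
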